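import Summits.NavierStokesRegularity.FunctionalMining.PalinstrophyLogDoorLargeC
import HarnessLib

/-!
# FunctionalMining — the threshold function `C₀(c)` of the log door (dict seat, staged v8)

Search for candidate a priori estimates; no regularity claim.

STAGED FILE (planner/dict seat cannot file under `FunctionalMining/`; the prove seat files it), third and
smallest module of the dict seat's log door: it must be filed AFTER `PalinstrophyLogDoor.lean`
(= `pub-nsfunc-dict/LogDoor.lean` v6) and `PalinstrophyLogDoorLargeC.lean` (= `pub-nsfunc-dict/LogDoorLargeC.lean`
v7) and imports the latter under the tree name above — adjust the import if the prove seat files it under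
another name. Staged 2026-08-20T00:29:12Z by planner-pub-nsfunc-dict-g5-0; checked on the farm as the tail of the combined
file `LogDoorFullT.lean` (door v6 + large-C v7 + this section): rc 0 / 0 errors / 0 warnings / 0 sorry,
`#print axioms logBudgetValid_eq_Ici_fin3` = [propext, Classical.choice, Quot.sound].

WHAT IT ADDS (order bookkeeping only — no analysis): the K1-Q3 verdict of record (DICTIONARY §9 N10 (ix))
is a statement about ONE function, the threshold
`logBudgetThreshold c := sInf {C | PalinstrophyLogBudget C c}` =: `C₀(c)`.
* `logBudgetValid c` is an up-set in `C` (`PalinstrophyLogBudget.mono`, door v6) and monotone in the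
  log-scale `c` on non-negative constants (`PalinstrophyLogBudget.mono_scale`);
* an invalid (refuted) constant is a lower bound of the valid set, a valid (proved) one an upper bound of
  `C₀(c)`; the valid set contains its infimum whenever it is non-empty (`logBudgetThreshold_mem`: the door
  is a family of non-strict inequalities); `C₀` is non-increasing in `c` (`logBudgetThreshold_anti`);
* at `d = Fin 3`, `c > 0`: the valid set is NON-EMPTY by the large-C theorem
  `palinstrophyLogBudgetLargeC_fin3_holds` (v7), hence every refuted constant lies below `C₀(c)`
  (`le_logBudgetThreshold_fin3` — this is where the no-go seat's exact certificates plug in: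
  `¬ PalinstrophyLogBudget (17/100) 1 → 17/100 ≤ C₀ 1`), `C₀(c)` is ATTAINED
  (`logBudgetThreshold_mem_fin3`, unconditional), and given one refuted constant the valid set is exactly
  the closed ray `[C₀(c), ∞)` (`logBudgetValid_eq_Ici_fin3`).
Nothing here is a regularity statement: `PalinstrophyLogBudget C c` is an a priori inequality along
classical solutions (BKM-type control at the `H²` level) and `C₀(c)` is the best constant in it.
-/

noncomputable section

open Set MeasureTheory
open scoped InnerProductSpace RealInnerProductSpace

namespace Summit.NavierStokesRegularity.FunctionalMining

open Literature.Analysis.FunctionSpaces Literature.Analysis.FluidPDE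

variable {d : Type*} [Fintype d] [DecidableEq d]

section Threshold

/-! ## The threshold function of the log door — the K1-Q3 verdict object (v8 section)

`logBudgetValid c = {C | PalinstrophyLogBudget C c}` is an up-set in `C` (for `c ≥ 0`), monotone in the
log-scale `c` on non-negative constants, and contains its infimum when non-empty and bounded below;
`logBudgetThreshold c := sInf (logBudgetValid c)` is the threshold `C₀(c)` of DICTIONARY §9 N10 (ix).
Bookkeeping statements: a valid `C` bounds `C₀(c)` from above (given any invalid constant), an invalid `C`
bounds it from below (given any valid constant), `C₀(c)` is itself valid (given any valid constant), and `C₀` is non-increasing in `c`.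
At `d = Fin 3`, `c > 0`, the valid set is non-empty by the large-C theorem
`palinstrophyLogBudgetLargeC_fin3_holds`; invalid constants are supplied by the no-go seat's exact
certificates once filed (e.g. `C = 17/100` at `c = 1`), after which every statement below is unconditional.
[ours; elementary order bookkeeping over Mathlib's conditionally complete lattice API]
Search for candidate a priori estimates; no regularity claim. -/

/-- The valid constants of the log door (a) at log-scale `c`. [ours] -/
def logBudgetValid (c : ℝ) : Set ℝ := {C | PalinstrophyLogBudget (d := d) C c}

/-- The threshold `C₀(c) = inf {C | PalinstrophyLogBudget C c}` (Mathlib's junk value when the set is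
empty or unbounded below — every use below carries the hypothesis it needs). [ours] -/
def logBudgetThreshold (c : ℝ) : ℝ := sInf (logBudgetValid (d := d) c)

/-- Membership in the valid set, unfolded. [ours] -/
theorem mem_logBudgetValid {C c : ℝ} :
    C ∈ logBudgetValid (d := d) c ↔ PalinstrophyLogBudget (d := d) C c := Iff.rfl

/-- Up-set in `C`. [ours] -/
theorem logBudgetValid_of_le {C C' c : ℝ} (hc : 0 ≤ c) (h : C ∈ logBudgetValid (d := d) c)
    (hCC' : C ≤ C') : C' ∈ logBudgetValid (d := d) c :=
  PalinstrophyLogBudget.mono h hc hCC'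

/-- Monotone in the log-scale for non-negative constants: a larger `c` only enlarges the right-hand
side. [ours] -/
theorem PalinstrophyLogBudget.mono_scale {C c c' : ℝ} (h : PalinstrophyLogBudget (d := d) C c)
    (hC : 0 ≤ C) (hc : 0 ≤ c) (hcc' : c ≤ c') : PalinstrophyLogBudget (d := d) C c' := by
  intro hd ν hν a b hab u p hsol t ht M hM hMx R hR
  refine (h hd hν hab hsol t ht M hM hMx R hR).trans ?_
  have hP : 0 ≤ torusPalinstrophy (u t) := torusPalinstrophy_nonneg _
  have h1 : (1 : ℝ) ≤ Real.exp 1 := by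
    have := Real.add_one_le_exp (1 : ℝ); linarith
  have hx : 0 < Real.exp 1 + c * torusPalinstrophy (u t) / ν ^ 2 := by
    have : 0 ≤ c * torusPalinstrophy (u t) / ν ^ 2 := div_nonneg (mul_nonneg hc hP) (sq_nonneg ν)
    linarith
  have hlog : Real.log (Real.exp 1 + c * torusPalinstrophy (u t) / ν ^ 2)
      ≤ Real.log (Real.exp 1 + c' * torusPalinstrophy (u t) / ν ^ 2) := by
    apply Real.log_le_log hx
    have : c * torusPalinstrophy (u t) / ν ^ 2 ≤ c' * torusPalinstrophy (u t) / ν ^ 2 :=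
      div_le_div_of_nonneg_right (mul_le_mul_of_nonneg_right hcc' hP) (sq_nonneg ν)
    linarith
  exact mul_le_mul_of_nonneg_left hlog (mul_nonneg (mul_nonneg hC hM) hP)

/-- An invalid constant is a lower bound of the valid set (contrapositive of the up-set property). [ours] -/
theorem mem_lowerBounds_logBudgetValid {C c : ℝ} (hc : 0 ≤ c)
    (h : C ∉ logBudgetValid (d := d) c) : C ∈ lowerBounds (logBudgetValid (d := d) c) := by
  intro C' hC'
  by_contra hlt
  exact h (logBudgetValid_of_le hc hC' (not_le.mp hlt).le)

/-- One invalid constant makes the valid set bounded below (`c ≥ 0`). [ours] -/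
theorem bddBelow_logBudgetValid {C c : ℝ} (hc : 0 ≤ c) (h : C ∉ logBudgetValid (d := d) c) :
    BddBelow (logBudgetValid (d := d) c) :=
  ⟨C, mem_lowerBounds_logBudgetValid hc h⟩

/-- A valid constant bounds the threshold from above. [ours] -/
theorem logBudgetThreshold_le {C c : ℝ} (hB : BddBelow (logBudgetValid (d := d) c))
    (h : PalinstrophyLogBudget (d := d) C c) : logBudgetThreshold (d := d) c ≤ C :=
  csInf_le hB h

/-- An invalid constant bounds the threshold from below. [ours] -/
theorem le_logBudgetThreshold {C c : ℝ} (hc : 0 ≤ c) (hne : (logBudgetValid (d := d) c).Nonempty)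
    (h : ¬ PalinstrophyLogBudget (d := d) C c) : C ≤ logBudgetThreshold (d := d) c :=
  le_csInf hne (mem_lowerBounds_logBudgetValid hc h)

/-- The valid set contains its infimum whenever it is non-empty: the threshold is itself a valid constant
(the door is a family of non-strict inequalities, closed under limits of the constant; if the set is not
bounded below every constant is valid, so no `BddBelow` hypothesis is needed). [ours] -/
theorem logBudgetThreshold_mem {c : ℝ} (hc : 0 ≤ c) (hne : (logBudgetValid (d := d) c).Nonempty) :
    PalinstrophyLogBudget (d := d) (logBudgetThreshold (d := d) c) c := by
  intro hd ν hν a b hab u p hsol t ht M hM hMx R hR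
  have hP : 0 ≤ torusPalinstrophy (u t) := torusPalinstrophy_nonneg _
  have hL : 0 ≤ Real.log (Real.exp 1 + c * torusPalinstrophy (u t) / ν ^ 2) := by
    apply Real.log_nonneg
    have h1 : (1 : ℝ) ≤ Real.exp 1 := by
      have := Real.add_one_le_exp (1 : ℝ); linarith
    have h2 : 0 ≤ c * torusPalinstrophy (u t) / ν ^ 2 := div_nonneg (mul_nonneg hc hP) (sq_nonneg ν)
    linarith
  obtain ⟨X, hX, hXdef⟩ : ∃ X : ℝ, 0 ≤ X ∧
      X = M * torusPalinstrophy (u t) * Real.log (Real.exp 1 + c * torusPalinstrophy (u t) / ν ^ 2) :=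
    ⟨_, mul_nonneg (mul_nonneg hM hP) hL, rfl⟩
  -- every valid constant `C'` gives `R ≤ C' * X`
  have hval : ∀ C' ∈ logBudgetValid (d := d) c, R ≤ C' * X := by
    intro C' hC'
    have h' := hC' hd hν hab hsol t ht M hM hMx R hR
    rw [hXdef, ← mul_assoc, ← mul_assoc]; exact h'
  -- conclude `R ≤ C₀ * X` by approximating the infimum from inside the set
  have goal : R ≤ logBudgetThreshold (d := d) c * X := by
    refine le_of_forall_pos_le_add fun ε hε => ?_
    rcases hX.eq_or_lt with hX0 | hXpos
    · obtain ⟨C', hC'⟩ := hne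
      have h' := hval C' hC'
      rw [← hX0, mul_zero] at h'
      rw [← hX0, mul_zero, zero_add]
      exact h'.trans hε.le
    · have hXne : X ≠ 0 := hXpos.ne'
      obtain ⟨C', hC'mem, hC'lt⟩ := exists_lt_of_csInf_lt hne
        (lt_add_of_pos_right (logBudgetThreshold (d := d) c) (div_pos hε hXpos))
      have h1 := hval C' hC'mem
      have h2 : C' * X ≤ (logBudgetThreshold (d := d) c + ε / X) * X :=
        mul_le_mul_of_nonneg_right hC'lt.le hX
      have h3 : (logBudgetThreshold (d := d) c + ε / X) * X
          = logBudgetThreshold (d := d) c * X + ε := by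
        rw [add_mul, div_mul_cancel₀ ε hXne]
      linarith
  rw [hXdef, ← mul_assoc, ← mul_assoc] at goal
  exact goal

/-- The threshold is non-increasing in the log-scale: for `0 ≤ c ≤ c'`, given a non-negative invalid
constant at `c`, a valid one at `c`, and an invalid one at `c'`. [ours] -/
theorem logBudgetThreshold_anti {c c' C₁ C₂ : ℝ} (hc : 0 ≤ c) (hcc' : c ≤ c') (hC₁ : 0 ≤ C₁)
    (h₁ : ¬ PalinstrophyLogBudget (d := d) C₁ c) (hne : (logBudgetValid (d := d) c).Nonempty)
    (h₂ : ¬ PalinstrophyLogBudget (d := d) C₂ c') :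
    logBudgetThreshold (d := d) c' ≤ logBudgetThreshold (d := d) c := by
  have hmem := logBudgetThreshold_mem hc hne
  have h0 : 0 ≤ logBudgetThreshold (d := d) c := hC₁.trans (le_logBudgetThreshold hc hne h₁)
  have hmem' : PalinstrophyLogBudget (d := d) (logBudgetThreshold (d := d) c) c' :=
    hmem.mono_scale h0 hc hcc'
  exact logBudgetThreshold_le (bddBelow_logBudgetValid (hc.trans hcc') h₂) hmem'

/-! ### At `d = Fin 3`: the valid set is non-empty (large-C theorem), so invalid constants sit below the
threshold and the threshold is attained unconditionally; the upper direction needs one invalid constant (no-go seat). -/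

/-- At `d = Fin 3` the valid set is non-empty for every `c > 0` (large-`C` theorem). [ours] -/
theorem logBudgetValid_nonempty_fin3 {c : ℝ} (hc : 0 < c) :
    (logBudgetValid (d := Fin 3) c).Nonempty := by
  obtain ⟨C, hC⟩ := palinstrophyLogBudgetLargeC_fin3_holds c hc
  exact ⟨C, hC⟩

/-- Every refuted constant lies below the threshold (`d = Fin 3`, `c > 0`). [ours] -/
theorem le_logBudgetThreshold_fin3 {C c : ℝ} (hc : 0 < c)
    (h : ¬ PalinstrophyLogBudget (d := Fin 3) C c) : C ≤ logBudgetThreshold (d := Fin 3) c :=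
  le_logBudgetThreshold hc.le (logBudgetValid_nonempty_fin3 hc) h

/-- Every proved constant lies above the threshold, given one refuted constant (`d = Fin 3`). [ours] -/
theorem logBudgetThreshold_le_fin3 {C C' c : ℝ} (hc : 0 < c)
    (h' : ¬ PalinstrophyLogBudget (d := Fin 3) C' c) (h : PalinstrophyLogBudget (d := Fin 3) C c) :
    logBudgetThreshold (d := Fin 3) c ≤ C :=
  logBudgetThreshold_le (bddBelow_logBudgetValid hc.le h') h

/-- The threshold is attained: `PalinstrophyLogBudget (C₀ c) c` holds at `d = Fin 3` for every `c > 0`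
(unconditional: the large-C theorem gives non-emptiness). [ours] -/
theorem logBudgetThreshold_mem_fin3 {c : ℝ} (hc : 0 < c) :
    PalinstrophyLogBudget (d := Fin 3) (logBudgetThreshold (d := Fin 3) c) c :=
  logBudgetThreshold_mem hc.le (logBudgetValid_nonempty_fin3 hc)

/-- Hence the valid set at `d = Fin 3`, `c > 0` is exactly the closed ray `[C₀(c), ∞)` as soon as one
constant is refuted (which supplies boundedness below). [ours] -/
theorem logBudgetValid_eq_Ici_fin3 {C' c : ℝ} (hc : 0 < c)
    (h' : ¬ PalinstrophyLogBudget (d := Fin 3) C' c) :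
    logBudgetValid (d := Fin 3) c = Set.Ici (logBudgetThreshold (d := Fin 3) c) := by
  ext C
  refine ⟨fun h => logBudgetThreshold_le_fin3 hc h' h, fun h => ?_⟩
  exact logBudgetValid_of_le hc.le (logBudgetThreshold_mem_fin3 hc) h

end Threshold

end Summit.NavierStokesRegularity.FunctionalMining
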